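import Mathlib
import Literature.NumberTheory.LFunctions.Zhang2022.Section15I2minusShift
import Literature.NumberTheory.LFunctions.Zhang2022.Section4ContourTools
import HarnessLib

/-!
# Zhang (2022) §15 p. 80, u008 part (γ): the EXACT left move `𝔍(−α) → 𝔍(−1)` of the u008 main term
# `M₁(s,ψ)ω(s)`, summed over `Ψ₁` — kernel-checked from Proposition 2.2 (i)

Topic `Literature/NumberTheory/LFunctions/Zhang2022` (Landau–Siegel audit tree; verdict-neutral).
Y. Zhang, *Discrete mean estimates and the Landau–Siegel zero*, arXiv:2211.02515v1 (2022)
[Zhang2022LandauSiegel] — **an unrefereed manuscript under adjudication; nothing in this file asserts or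
denies its Theorems 1–2.** ZHANG-L discharge lane, leaf `Typed.Section15A.Eq15_6 c′ bChi` (h15_6),
node `Z22:§15.u008` [Z22 p.80, tex L4017–L4033], typed sub-node `Typed.Section15A.Step15_u008gamma`
(`TypedSection15ASubsteps`), WP15-internal route of record RT15-int-1
(zl-w15-plan 2026-08-27T00:02Z): u008 ⇐ (α) pointwise `𝔨₁ = M₁(1+O(𝓛⁻¹²³))` on `𝔍(−α)`
(`Typed.Section15A.step15_u008alpha_holds`, zl-w15-p6) + (β) the mean value `Σ_{Ψ₁}∫_{𝔍(−α)}|M₁ω| ≪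
𝔓𝓛¹²²` + (γ) THIS FILE + (δ) = u007. Here

  `M₁(s,ψ) = τ(χ)χ(p)ψ̄(D)(pt₀)^{−β₃}D^{s−1}·(L(1−s−β₁,ψ̄)L(1−s−β₂,ψ̄)/L(1−s,ψ̄))·B(s,ψ)K(1−s−β₃,ψ̄)`

(written INLINE below in the term order of `step15_u008alpha_holds`), and the theorem is

> (γ) `‖Σ_{ψ∈Ψ₁}(1/2πi)∫_{𝔍(−α)}M₁ω − Σ_{ψ∈Ψ₁}(1/2πi)∫_{𝔍(−1)}M₁ω‖ ≤ C·e^{−c𝓛¹⁰}` (`c = 1/16`),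

the manuscript's "moving the segment `𝔍(−α)` to `𝔍(−1)` with a negligible error" applied to the main
term. Mechanism = the tree's left move of `𝔨₁ω` (`Step15u008.step15_u008a_holds`, file
`Section15I2minusShift`): `M₁ω` is holomorphic on `[−½, ½−α]×[2πt₀−𝓛₁, 2πt₀+𝓛₁]` because
`L(1−s,ψ̄) = conj L(1−s̄,ψ)` has `Re(1−s̄) ∈ [½+α, 3/2]` where `L(·,ψ)` is zero-free by Prop. 2.2 (i)
(`Step8u016.LFunction_ne_zero_of_onLine`); on the horizontal sides `|M₁ω| ≤ K·P¹¹·e^{3C𝓛⁹(1+9log𝓛)}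
·e^{2−𝓛¹⁰/4}` (`|τ(χ)| ≤ D`, `|D^{s−1}| ≤ 1`, `|L(1−s−β_j,ψ̄)| = |L(1−s̄+ib_j,ψ)| ≤ p(t+6)Z`,
`|L(1−s,ψ̄)|⁻¹ ≤ e^{C(1+log(1/α))ℒ}` by the tree's `DirichletDisc.exp_neg_le_norm_LFunction`, trivial
bounds for `B`, `K`, `|ω| ≤ e^{2−𝓛¹⁰/4}`); Cauchy's theorem (`Section7aStatements.norm_intJ_sub_intJ_le`)
and the count `#Ψ₁ ≤ 4P²`. Theorems only; no definitions, no named facts.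
WHAT THIS IS NOT: a proof of (β), of u008 or (15.4), or any claim about Theorems 1–2 of the source or
about Landau–Siegel zeros.

## References

* Y. Zhang, arXiv:2211.02515v1 (2022), §15 p. 80 (tex L4017–L4033); §2 (2.2). [cite: Zhang2022LandauSiegel, §15 p. 80 (u008)]
* H. L. Montgomery, R. C. Vaughan, *Multiplicative Number Theory I* (2007), Lemma 12.6. [cite: MontgomeryVaughan2007, Lemma 12.6]
-/

noncomputable section

open Complex Real Set ComplexConjugate

namespace Literature.NumberTheory.LFunctions.Zhang2022.Step15u008

open Literature.NumberTheory.LFunctions.Zhang2022 Skeleton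
open Literature.NumberTheory.LFunctions.Zhang2022.Typed.Section15A

/-! ## A. The reflected `L`-values: non-vanishing and size -/

section Reflected

variable (c' : ℝ) {D : ℕ} [NeZero D] {χ : DirichletCharacter ℂ D} (x : Chr D)

omit [NeZero D] in
/-- `conj(1 − s − ib) = (1 − Re s) + i(Im s + b)`, in the shape `s′ + ib` with `s′ = (1 − Re s) + i·Im s`.
[folklore] -/
private theorem conj_one_sub_sub (s : ℂ) (b : ℝ) :
    conj (1 - s - (b : ℂ) * I) = ((1 - s.re : ℝ) : ℂ) + s.im * I + (b : ℂ) * I := by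
  apply Complex.ext <;> simp

omit c' in
/-- **`L(1−s,ψ̄) ≠ 0` on the left rectangle** (`σ < ½`, `|t − 2πt₀| < 𝓛₁ + 2`), for `ψ ∈ Ψ₁` under
Prop. 2.2 (i): `L(1−s,ψ̄) = conj L(1−s̄,ψ)` and `Re(1−s̄) > ½` (`Step8u016.LFunction_ne_zero_of_onLine`).
[cite: Zhang2022LandauSiegel, §15 p. 80; §2 Prop. 2.2 (i)] -/
theorem LFunction_inv_one_sub_ne_zero (h22 : ∀ s ∈ prodZeroSetOmega χ x, s.re = 1 / 2) {s : ℂ}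
    (hre : s.re < 1 / 2) (him : |s.im - 2 * π * t0 D| < ell1 D + 2) :
    x.ψ⁻¹.LFunction (1 - s) ≠ 0 := by
  rw [Typed.Section13.LFunction_inv_conj x (1 - s)]
  have h1 : conj (1 - s) = ((1 - s.re : ℝ) : ℂ) + s.im * I := by
    apply Complex.ext <;> simp
  rw [h1]
  intro h0
  have h0' : x.ψ.LFunction (((1 - s.re : ℝ) : ℂ) + s.im * I) = 0 := by
    simpa using h0
  exact Step8u016.LFunction_ne_zero_of_onLine h22 (s := ((1 - s.re : ℝ) : ℂ) + s.im * I)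
    (by simp; linarith) (by simpa using him) h0'

omit c' in
/-- **`|L(1−s,ψ̄)⁻¹| ≤ exp(C(1+log(1/α))(log p + log(|t|+4)))`** for `s = u + it`, `−½ ≤ u ≤ ½−α`,
`|t − 2πt₀| ≤ 𝓛₁`, `ψ ∈ Ψ₁` under Prop. 2.2 (i): `|L(1−s,ψ̄)| = |L((1−u)+it,ψ)|` with
`1−u ∈ [½+α, 3/2]`, and the zeros of `L(·,ψ)` in the Montgomery–Vaughan disc at height `t` are on the
line. [cite: MontgomeryVaughan2007, Lemma 12.6] [cite: Zhang2022LandauSiegel, §15 p. 80] -/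
theorem norm_LFunction_inv_one_sub_inv_le {C : ℝ}
    (hC : ∀ (q : ℕ) [NeZero q] (θ : DirichletCharacter ℂ q), θ ≠ 1 → ∀ t σ d : ℝ,
      1 / 2 ≤ σ → σ ≤ 2 → 0 < d → d ≤ 1 →
        (∀ ρ ∈ DirichletDisc.discZeros θ t, ∀ y ∈ Icc σ 2, d ≤ ‖(y : ℂ) + t * I - ρ‖) →
          Real.exp (-(C * (1 + Real.log (1 / d)) * (Real.log q + Real.log (|t| + 4)))) ≤
            ‖θ.LFunction ((σ : ℂ) + t * I)‖)
    (h22 : ∀ s ∈ prodZeroSetOmega χ x, s.re = 1 / 2) (hα0 : 0 < alpha D) (hα1 : alpha D ≤ 1)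
    {u t : ℝ} (hu1 : -1 / 2 ≤ u) (hu2 : u ≤ 1 / 2 - alpha D) (ht : |t - 2 * π * t0 D| ≤ ell1 D) :
    ‖(x.ψ⁻¹.LFunction (1 - ((u : ℂ) + t * I)))⁻¹‖ ≤
      Real.exp (C * (1 + Real.log (1 / alpha D)) * (Real.log x.p + Real.log (|t| + 4))) := by
  set s : ℂ := (u : ℂ) + t * I with hs
  have hconj : x.ψ⁻¹.LFunction (1 - s) = conj (x.ψ.LFunction (((1 - u : ℝ) : ℂ) + t * I)) := by
    rw [Typed.Section13.LFunction_inv_conj x (1 - s)]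
    congr 2
    apply Complex.ext <;> simp [hs]
  have hdist := DirichletDisc.dist_segment_of_re_le (χ := x.ψ) (t := t) (σ := 1 - u) (d := alpha D)
    (fun ρ hρ => by rw [Step8u016.discZeros_re_eq_half h22 ht ρ hρ]; linarith)
  have hlow := hC x.p x.ψ x.ψ_ne_one t (1 - u) (alpha D) (by linarith) (by linarith) hα0 hα1 hdist
  set E : ℝ := Real.exp (C * (1 + Real.log (1 / alpha D)) * (Real.log x.p + Real.log (|t| + 4)))
    with hE
  have hE0 : 0 < E := Real.exp_pos _
  have hLn : ‖x.ψ⁻¹.LFunction (1 - s)‖ = ‖x.ψ.LFunction (((1 - u : ℝ) : ℂ) + t * I)‖ := by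
    rw [hconj, Complex.norm_conj]
  have hLs0 : 0 < ‖x.ψ⁻¹.LFunction (1 - s)‖ := by
    rw [hLn]; exact lt_of_lt_of_le (Real.exp_pos _) hlow
  rw [norm_inv, inv_le_comm₀ hLs0 hE0, hE, ← Real.exp_neg, hLn]
  exact hlow

omit [NeZero D] in
/-- **`|L(1−s−β_j,ψ̄)| ≤ p(|t|+6)Z`** for `½ ≤ 1 − Re s ≤ 2` and `|b_j| ≤ 1` (`β_j = ib_j`):
`L(1−s−ib,ψ̄) = conj L((1−σ) + i(t+b),ψ)` and the tree's crude bound on the Montgomery–Vaughan discs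
(`Step8u016.norm_LFunction_shift_le`). [cite: MontgomeryVaughan2007, Lemma 10.15] -/
theorem norm_LFunction_inv_refl_shift_le {s : ℂ} (hre1 : -1 ≤ s.re) (hre2 : s.re ≤ 1 / 2) {b : ℝ}
    (hb : |b| ≤ 1) (ht0 : 0 ≤ s.im) :
    ‖x.ψ⁻¹.LFunction (1 - s - (b : ℂ) * I)‖ ≤ x.p * (s.im + 6) * DirichletDisc.Zc := by
  rw [Typed.Section13.LFunction_inv_conj x, Complex.norm_conj, conj_one_sub_sub]
  have hre : (((1 - s.re : ℝ) : ℂ) + s.im * I).re ∈ Icc (1 / 2 : ℝ) 2 := by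
    simp only [add_re, ofReal_re, mul_re, I_re, mul_zero, ofReal_im, I_im, mul_one, sub_self,
      add_zero, mem_Icc]
    constructor <;> linarith
  have h := Step8u016.norm_LFunction_shift_le x hre hb
  have him : (((1 - s.re : ℝ) : ℂ) + s.im * I).im = s.im := by simp
  rw [him, abs_of_nonneg ht0] at h
  have hp : (0 : ℝ) ≤ x.p := Nat.cast_nonneg _
  have hZ : 0 ≤ DirichletDisc.Zc := le_trans zero_le_one DirichletDisc.one_le_Zc
  refine h.trans ?_
  gcongr
  linarith

end Reflected

/-! ## B. Holomorphy of `M₁ω` on the closed left rectangle -/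

section Holomorphy

variable (c' : ℝ) {D : ℕ} [NeZero D] (χ : DirichletCharacter ℂ D) (x : Chr D)

/-- **`M₁(s,ψ)ω(s)` is holomorphic on `[−½, ½−α] × [2πt₀−𝓛₁, 2πt₀+𝓛₁]`** for `ψ ∈ Ψ₁` with the zeros
of `L(s,ψ)L(s,ψχ)` in `Ω` on the line: `D^{s−1}`, `L(1−s−β_j,ψ̄)`, `B`, `K`, `ω` are entire and
`L(1−s,ψ̄) ≠ 0` there (`LFunction_inv_one_sub_ne_zero`). [cite: Zhang2022LandauSiegel, §15 p. 80 (u008)] -/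
theorem differentiableOn_mainU008_omega_left
    (h22 : ∀ s ∈ prodZeroSetOmega χ x, s.re = 1 / 2)
    (hα0 : 0 < alpha D) (hα1 : alpha D ≤ 1) :
    DifferentiableOn ℂ (fun s =>
      GammaFactor.tau χ * χ (x.p : ZMod D) * conj (x.ψ (D : ZMod x.p)) *
        (((x.p : ℝ) * t0 D : ℝ) : ℂ) ^ (-beta3 c' D) * (D : ℂ) ^ (s - 1) *
        (x.ψ⁻¹.LFunction (1 - s - beta1 c' D) * x.ψ⁻¹.LFunction (1 - s - beta2 c' D) /
          x.ψ⁻¹.LFunction (1 - s)) *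
        Bpoly χ x s * Kchar D (psiBarFn x) (1 - s - beta3 c' D) * omegaW D s)
      (Set.uIcc (1 / 2 + (-1 : ℝ)) (1 / 2 + (-alpha D)) ×ℂ
        Set.uIcc (2 * π * t0 D - ell1 D) (2 * π * t0 D + ell1 D)) := by
  intro s hs
  have hre : 1 / 2 + (-1 : ℝ) ≤ s.re ∧ s.re ≤ 1 / 2 + (-alpha D) := by
    have h := hs.1
    rw [Set.uIcc_of_le (by linarith)] at h
    exact h
  have hℓ1 : 0 ≤ ell1 D := pow_nonneg (Real.log_natCast_nonneg D) _
  have him : 2 * π * t0 D - ell1 D ≤ s.im ∧ s.im ≤ 2 * π * t0 D + ell1 D := by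
    have h := hs.2
    rw [Set.uIcc_of_le (by linarith)] at h
    exact h
  have himw : |s.im - 2 * π * t0 D| < ell1 D + 2 := by
    rw [abs_lt]; constructor <;> linarith
  have hL : x.ψ⁻¹.LFunction (1 - s) ≠ 0 :=
    LFunction_inv_one_sub_ne_zero x h22 (by linarith [hre.2]) himw
  have hinv1 : x.ψ⁻¹ ≠ 1 := fun h => x.ψ_ne_one (inv_eq_one.mp h)
  have hLd := DirichletCharacter.differentiable_LFunction hinv1
  have hD0 : (D : ℂ) ≠ 0 := Nat.cast_ne_zero.mpr (NeZero.ne D)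
  have hpow : DifferentiableAt ℂ (fun s : ℂ => (D : ℂ) ^ (s - 1)) s :=
    (differentiableAt_id.sub_const 1).const_cpow (Or.inl hD0)
  have hL1 : DifferentiableAt ℂ (fun s => x.ψ⁻¹.LFunction (1 - s - beta1 c' D)) s :=
    (hLd.comp (((differentiable_const (1 : ℂ)).sub differentiable_id).sub_const _)).differentiableAt
  have hL2 : DifferentiableAt ℂ (fun s => x.ψ⁻¹.LFunction (1 - s - beta2 c' D)) s :=
    (hLd.comp (((differentiable_const (1 : ℂ)).sub differentiable_id).sub_const _)).differentiableAt
  have hL0 : DifferentiableAt ℂ (fun s => x.ψ⁻¹.LFunction (1 - s)) s :=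
    (hLd.comp ((differentiable_const (1 : ℂ)).sub differentiable_id)).differentiableAt
  have hB : DifferentiableAt ℂ (Bpoly χ x) s :=
    (Typed.Section17.differentiable_Bpoly χ x).differentiableAt
  have hK : DifferentiableAt ℂ (fun s => Kchar D (psiBarFn x) (1 - s - beta3 c' D)) s :=
    ((Step16u010.differentiable_Kchar (psiBarFn x)).comp
      (((differentiable_const (1 : ℂ)).sub differentiable_id).sub_const _)).differentiableAt
  have hω : DifferentiableAt ℂ (omegaW D) s := (Section7aStatements.differentiable_omegaW D) s
  exact ((((((differentiableAt_const _).mul hpow).mul ((hL1.mul hL2).div hL0 hL)).mul hB).mul hK).mul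
    hω).differentiableWithinAt

end Holomorphy

/-! ## C. The size of `M₁ω` on the horizontal sides of the left rectangle -/

section EdgeBound

variable (c' : ℝ) {D : ℕ} [NeZero D] {χ : DirichletCharacter ℂ D} (x : Chr D)

omit [NeZero D] in
/-- `t₀ ≥ 729`, `𝓛₁ ≤ t₀`, `𝓛₁ < 2πt₀`, `342 ≤ 2πt₀ − 𝓛₁` for `𝓛 ≥ 3`. [cite: Zhang2022LandauSiegel, §2 (2.8)] -/
private theorem window_sizes_left' (hℓ : 3 ≤ ell D) :
    729 ≤ t0 D ∧ ell1 D ≤ t0 D ∧ ell1 D < 2 * π * t0 D ∧ 342 ≤ 2 * π * t0 D - ell1 D ∧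
      0 ≤ ell1 D := by
  have hℓ1 : 1 ≤ ell D := by linarith
  have h6 : (3 : ℝ) ^ 6 ≤ ell D ^ 6 := pow_le_pow_left₀ (by norm_num) hℓ 6
  have h6' : ell D ^ 6 ≤ ell D ^ 519 := pow_le_pow_right₀ hℓ1 (by norm_num)
  have h1 : ell D ^ 405 ≤ ell D ^ 519 := pow_le_pow_right₀ hℓ1 (by norm_num)
  rw [ell1, t0]
  refine ⟨by nlinarith, h1, by nlinarith [Real.pi_gt_three], by nlinarith [Real.pi_gt_three],
    by positivity⟩

/-- **`M₁ω` on the horizontal sides of the LEFT rectangle.** For `ψ ∈ Ψ₁` with the zeros of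
`L(s,ψ)L(s,ψχ)` in `Ω` on the line, `χ` primitive, `𝓛 ≥ 3`, `α ≤ 1/6`, `|c′|α𝓛 ≤ 1`, and `s = u + it`
with `−½ ≤ u ≤ ½−α`, `|t − 2πt₀| ≤ 𝓛₁`, `𝓛₁ − 1 ≤ |t − 2πt₀|`:
`|M₁(s,ψ)ω(s)| ≤ D·[p(t+6)Z]²·e^{C(1+log(1/α))(log p+log(|t|+4))}·K_B(P+1)⁴·(2Pt₀+1)·e^{2−𝓛¹⁰/4}`.
[cite: Zhang2022LandauSiegel, §15 p. 80 (u008)] -/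
theorem norm_mainU008_omega_le_left {C : ℝ}
    (hC : ∀ (q : ℕ) [NeZero q] (θ : DirichletCharacter ℂ q), θ ≠ 1 → ∀ t σ d : ℝ,
      1 / 2 ≤ σ → σ ≤ 2 → 0 < d → d ≤ 1 →
        (∀ ρ ∈ DirichletDisc.discZeros θ t, ∀ y ∈ Icc σ 2, d ≤ ‖(y : ℂ) + t * I - ρ‖) →
          Real.exp (-(C * (1 + Real.log (1 / d)) * (Real.log q + Real.log (|t| + 4)))) ≤
            ‖θ.LFunction ((σ : ℂ) + t * I)‖)
    (h22 : ∀ s ∈ prodZeroSetOmega χ x, s.re = 1 / 2)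
    (hℓ3 : 3 ≤ ell D) (hα0 : 0 < alpha D) (hα : alpha D ≤ 1 / 6)
    (hc : |c'| * (alpha D * ell D) ≤ 1)
    {u t : ℝ} (hu1 : -1 / 2 ≤ u) (hu2 : u ≤ 1 / 2 - alpha D)
    (ht : |t - 2 * π * t0 D| ≤ ell1 D) (ht1 : ell1 D - 1 ≤ |t - 2 * π * t0 D|) :
    ‖GammaFactor.tau χ * χ (x.p : ZMod D) * conj (x.ψ (D : ZMod x.p)) *
        (((x.p : ℝ) * t0 D : ℝ) : ℂ) ^ (-beta3 c' D) * (D : ℂ) ^ (((u : ℂ) + t * I) - 1) *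
        (x.ψ⁻¹.LFunction (1 - ((u : ℂ) + t * I) - beta1 c' D) *
            x.ψ⁻¹.LFunction (1 - ((u : ℂ) + t * I) - beta2 c' D) /
          x.ψ⁻¹.LFunction (1 - ((u : ℂ) + t * I))) *
        Bpoly χ x ((u : ℂ) + t * I) * Kchar D (psiBarFn x) (1 - ((u : ℂ) + t * I) - beta3 c' D) *
        omegaW D ((u : ℂ) + t * I)‖ ≤
      (D : ℝ) * ((x.p : ℝ) * (t + 6) * DirichletDisc.Zc) ^ 2 *
        Real.exp (C * (1 + Real.log (1 / alpha D)) * (Real.log x.p + Real.log (|t| + 4))) *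
        ((1 + ‖iota2‖) * (‖iota3‖ + ‖iota4‖) * (bigP D + 1) ^ 4) * (2 * bigP D * t0 D + 1) *
        Real.exp (2 - ell D ^ 10 / 4) := by
  set s : ℂ := (u : ℂ) + t * I with hs
  have hsre : s.re = u := by simp [hs]
  have hsim : s.im = t := by simp [hs]
  obtain ⟨ht0729, hℓ1t0, hwin, h342, hℓ10⟩ := window_sizes_left' hℓ3
  have ht342 : 342 ≤ t := by have := (abs_le.mp ht).1; linarith
  have ht0 : 0 < t := by linarith
  have hp0 : (0 : ℝ) < x.p := by exact_mod_cast x.prime.pos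
  have hℓ : 1 ≤ ell D := by linarith
  have hℓ0 : 0 < ell D := by linarith
  have hℓ2 : 2 ≤ Real.log D := by rw [← ell]; linarith
  have hα1 : alpha D ≤ 1 := by linarith
  obtain ⟨hb1, hb2, -⟩ := Step8u016.abs_b_le_one c' hα0.le hα hc
  obtain ⟨e1, e2, e3⟩ := Section8aStatements.beta_eq_b_mul_I c' D
  have hZ1 : 1 ≤ DirichletDisc.Zc := DirichletDisc.one_le_Zc
  have hD1 : (1 : ℝ) ≤ D := by
    have : 1 ≤ D := Nat.one_le_iff_ne_zero.mpr (NeZero.ne D)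
    exact_mod_cast this
  -- constant factors
  have f1 : ‖GammaFactor.tau χ‖ ≤ D := Section4.norm_tau_le χ
  have f2 : ‖χ (x.p : ZMod D)‖ ≤ 1 := χ.norm_le_one _
  have f3 : ‖conj (x.ψ (D : ZMod x.p))‖ ≤ 1 := by rw [Complex.norm_conj]; exact x.ψ.norm_le_one _
  have f4 : ‖(((x.p : ℝ) * t0 D : ℝ) : ℂ) ^ (-beta3 c' D)‖ = 1 :=
    Typed.Section13.norm_ptcpow_eq_one (by linarith) x (by rw [Complex.neg_re, e3]; simp)
  have f5 : ‖(D : ℂ) ^ (s - 1)‖ ≤ 1 := by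
    rw [Complex.norm_natCast_cpow_of_pos (Nat.pos_of_ne_zero (NeZero.ne D))]
    exact Real.rpow_le_one_of_one_le_of_nonpos hD1 (by rw [Complex.sub_re, hsre, Complex.one_re]; linarith)
  -- the reflected `L`-values
  have hLj : ∀ b : ℝ, |b| ≤ 1 →
      ‖x.ψ⁻¹.LFunction (1 - s - (b : ℂ) * I)‖ ≤ x.p * (t + 6) * DirichletDisc.Zc := by
    intro b hb
    have h := norm_LFunction_inv_refl_shift_le x (s := s) (by rw [hsre]; linarith)
      (by rw [hsre]; linarith) hb (by rw [hsim]; exact ht0.le)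
    rw [hsim] at h; exact h
  have g1 : ‖x.ψ⁻¹.LFunction (1 - s - beta1 c' D)‖ ≤ x.p * (t + 6) * DirichletDisc.Zc := by
    rw [e1]; exact hLj _ hb1
  have g2 : ‖x.ψ⁻¹.LFunction (1 - s - beta2 c' D)‖ ≤ x.p * (t + 6) * DirichletDisc.Zc := by
    rw [e2]; exact hLj _ hb2
  set E : ℝ := Real.exp (C * (1 + Real.log (1 / alpha D)) * (Real.log x.p + Real.log (|t| + 4)))
    with hE
  have hE0 : 0 < E := Real.exp_pos _
  have g0 : ‖(x.ψ⁻¹.LFunction (1 - s))⁻¹‖ ≤ E :=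
    norm_LFunction_inv_one_sub_inv_le x hC h22 hα0 hα1 hu1 hu2 ht
  -- Dirichlet polynomials and the weight
  set KB : ℝ := (1 + ‖iota2‖) * (‖iota3‖ + ‖iota4‖) with hKB
  have hKB0 : 0 ≤ KB := by rw [hKB]; positivity
  have hF5 : ‖Bpoly χ x s‖ ≤ KB * (bigP D + 1) ^ 4 :=
    Eq177.norm_Bpoly_le_left χ x hℓ2 (by rw [hsre]; linarith)
  have hF6 : ‖Kchar D (psiBarFn x) (1 - s - beta3 c' D)‖ ≤ 2 * bigP D * t0 D + 1 := by
    refine norm_Kchar_psiBar_le x hℓ0 ?_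
    have hre3 : (1 - s - beta3 c' D).re = 1 - u := by
      rw [e3]; simp [hs]
    rw [hre3]; linarith
  have hF7 : ‖omegaW D s‖ ≤ Real.exp (2 - ell D ^ 10 / 4) :=
    Section8aStatements.norm_omegaW_le_exp (by linarith) (by rw [hsre, abs_le]; constructor <;> linarith)
      (by rw [hsim]; exact ht1)
  -- assembly
  have hP0 : 0 ≤ bigP D := (Real.exp_pos _).le
  have hpt : 0 ≤ (x.p : ℝ) * (t + 6) * DirichletDisc.Zc := by positivity
  have hquot : ‖x.ψ⁻¹.LFunction (1 - s - beta1 c' D) * x.ψ⁻¹.LFunction (1 - s - beta2 c' D) /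
      x.ψ⁻¹.LFunction (1 - s)‖ ≤ ((x.p : ℝ) * (t + 6) * DirichletDisc.Zc) ^ 2 * E := by
    rw [div_eq_mul_inv, norm_mul, norm_mul]
    have h := mul_le_mul (mul_le_mul g1 g2 (norm_nonneg _) hpt) g0 (norm_nonneg _)
      (mul_nonneg hpt hpt)
    refine h.trans (le_of_eq ?_); ring
  have hconst : ‖GammaFactor.tau χ * χ (x.p : ZMod D) * conj (x.ψ (D : ZMod x.p)) *
      (((x.p : ℝ) * t0 D : ℝ) : ℂ) ^ (-beta3 c' D) * (D : ℂ) ^ (s - 1)‖ ≤ D := by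
    rw [norm_mul, norm_mul, norm_mul, norm_mul, f4]
    have hD0 : (0 : ℝ) ≤ D := Nat.cast_nonneg _
    calc ‖GammaFactor.tau χ‖ * ‖χ (x.p : ZMod D)‖ * ‖conj (x.ψ (D : ZMod x.p))‖ * 1 *
          ‖(D : ℂ) ^ (s - 1)‖ ≤ D * 1 * 1 * 1 * 1 := by
          gcongr
      _ = D := by ring
  rw [norm_mul, norm_mul, norm_mul, norm_mul]
  have hD0 : (0 : ℝ) ≤ D := Nat.cast_nonneg _
  have n2 : 0 ≤ ((x.p : ℝ) * (t + 6) * DirichletDisc.Zc) ^ 2 * E := by positivity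
  have n5 : 0 ≤ KB * (bigP D + 1) ^ 4 := mul_nonneg hKB0 (pow_nonneg (by linarith) _)
  have ht00 : 0 ≤ t0 D := by linarith
  have n6 : 0 ≤ 2 * bigP D * t0 D + 1 :=
    add_nonneg (mul_nonneg (mul_nonneg (by norm_num) hP0) ht00) zero_le_one
  have k1 := mul_le_mul hconst hquot (norm_nonneg _) hD0
  have k2 := mul_le_mul k1 hF5 (norm_nonneg _) (mul_nonneg hD0 n2)
  have k3 := mul_le_mul k2 hF6 (norm_nonneg _) (mul_nonneg (mul_nonneg hD0 n2) n5)
  have k4 := mul_le_mul k3 hF7 (norm_nonneg _) (mul_nonneg (mul_nonneg (mul_nonneg hD0 n2) n5) n6)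
  refine k4.trans (le_of_eq ?_)
  rw [hKB]; ring

set_option maxHeartbeats 800000 in
/-- **`M₁ω` on either horizontal side of the left rectangle, uniformly in `ψ` and `u`**: with the
hypotheses of `norm_mainU008_omega_le_left`, `D ≥ 3`, `𝓛 ≥ 3` and `π|c′| ≤ 𝓛⁸`, on
`s = u + i(2πt₀ ± 𝓛₁)`, `−½ ≤ u ≤ ½−α`:
`|M₁(s,ψ)ω(s)| ≤ K·P¹¹·exp(3C𝓛⁹(1+9log𝓛))·e^{2−𝓛¹⁰/4}`, `K = (3·14·Z)²·K_B·16·3`.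
[cite: Zhang2022LandauSiegel, §15 p. 80 (u008)] -/
theorem norm_mainU008_omega_le_left_uniform {C : ℝ} (hC0 : 0 < C)
    (hC : ∀ (q : ℕ) [NeZero q] (θ : DirichletCharacter ℂ q), θ ≠ 1 → ∀ t σ d : ℝ,
      1 / 2 ≤ σ → σ ≤ 2 → 0 < d → d ≤ 1 →
        (∀ ρ ∈ DirichletDisc.discZeros θ t, ∀ y ∈ Icc σ 2, d ≤ ‖(y : ℂ) + t * I - ρ‖) →
          Real.exp (-(C * (1 + Real.log (1 / d)) * (Real.log q + Real.log (|t| + 4)))) ≤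
            ‖θ.LFunction ((σ : ℂ) + t * I)‖)
    (x : Chr D) (h22 : ∀ s ∈ prodZeroSetOmega χ x, s.re = 1 / 2) (hD : 3 ≤ D)
    (hℓ : 3 ≤ ell D) (hc : π * |c'| ≤ ell D ^ 8)
    {u : ℝ} (hu1 : -1 / 2 ≤ u) (hu2 : u ≤ 1 / 2 - alpha D) {t : ℝ}
    (ht : t = 2 * π * t0 D + ell1 D ∨ t = 2 * π * t0 D - ell1 D) :
    ‖GammaFactor.tau χ * χ (x.p : ZMod D) * conj (x.ψ (D : ZMod x.p)) *
        (((x.p : ℝ) * t0 D : ℝ) : ℂ) ^ (-beta3 c' D) * (D : ℂ) ^ (((u : ℂ) + t * I) - 1) *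
        (x.ψ⁻¹.LFunction (1 - ((u : ℂ) + t * I) - beta1 c' D) *
            x.ψ⁻¹.LFunction (1 - ((u : ℂ) + t * I) - beta2 c' D) /
          x.ψ⁻¹.LFunction (1 - ((u : ℂ) + t * I))) *
        Bpoly χ x ((u : ℂ) + t * I) * Kchar D (psiBarFn x) (1 - ((u : ℂ) + t * I) - beta3 c' D) *
        omegaW D ((u : ℂ) + t * I)‖ ≤
      ((3 * 14 * DirichletDisc.Zc) ^ 2 * ((1 + ‖iota2‖) * (‖iota3‖ + ‖iota4‖)) * 16 * 3) *
        bigP D ^ 11 * Real.exp (3 * C * ell D ^ 9 * (1 + 9 * Real.log (ell D))) *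
        Real.exp (2 - ell D ^ 10 / 4) := by
  obtain ⟨hα0, hα6, hα1⟩ := Step8u016.alpha_small hℓ
  obtain ⟨ht0729, hℓ1t0, hwin, h342, hℓ10⟩ := window_sizes_left' hℓ
  have hcα := Step8u016.abs_c_mul_alpha_ell_le_one hℓ hc
  have hπ3 := Real.pi_gt_three
  have hπt : π * t0 D ≤ 7 / 2 * t0 D :=
    mul_le_mul_of_nonneg_right (by linarith [Real.pi_lt_d2]) (by linarith)
  have htabs : |t - 2 * π * t0 D| ≤ ell1 D := by
    rcases ht with ht' | ht'
    · rw [ht', show 2 * π * t0 D + ell1 D - 2 * π * t0 D = ell1 D by ring, abs_of_nonneg hℓ10]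
    · rw [ht', show 2 * π * t0 D - ell1 D - 2 * π * t0 D = -ell1 D by ring, abs_neg,
        abs_of_nonneg hℓ10]
  have htabs1 : ell1 D - 1 ≤ |t - 2 * π * t0 D| := by
    rcases ht with ht' | ht'
    · rw [ht', show 2 * π * t0 D + ell1 D - 2 * π * t0 D = ell1 D by ring, abs_of_nonneg hℓ10]
      linarith
    · rw [ht', show 2 * π * t0 D - ell1 D - 2 * π * t0 D = -ell1 D by ring, abs_neg,
        abs_of_nonneg hℓ10]
      linarith
  have ht1 : 342 ≤ t := by rcases ht with ht' | ht' <;> rw [ht'] <;> linarith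
  have ht0 : 0 < t := by linarith
  have htle : t ≤ 8 * t0 D := by rcases ht with ht' | ht' <;> rw [ht'] <;> linarith
  -- sizes
  have hP0 : 0 < bigP D := Real.exp_pos _
  have hP1 : 1 ≤ bigP D := Real.one_le_exp (pow_nonneg (Real.log_natCast_nonneg D) 9)
  have hp3 := Step8u016.chr_p_le_three_bigP hℓ x
  have hp1 : (1 : ℝ) ≤ x.p := by exact_mod_cast x.prime.one_lt.le
  have hp0 : (0 : ℝ) ≤ x.p := by linarith
  have ht0P := Step8u016.t0_le_bigP hℓ
  have hDP := Step16u010.natCast_le_bigP (D := D) hD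
  have hD0 : (0 : ℝ) ≤ D := Nat.cast_nonneg _
  have hZ1 : 1 ≤ DirichletDisc.Zc := DirichletDisc.one_le_Zc
  have hZ0 : 0 ≤ DirichletDisc.Zc := by linarith
  set KB : ℝ := (1 + ‖iota2‖) * (‖iota3‖ + ‖iota4‖) with hKB
  have hKB0 : 0 ≤ KB := by rw [hKB]; positivity
  have ht8P : t ≤ 8 * bigP D := by linarith
  have ht4 : |t| + 4 ≤ 12 * bigP D := by rw [abs_of_pos ht0]; linarith
  -- factor 1: `D ≤ P`
  -- factor 2: `(p(t+6)Z)² ≤ (3P·14P·Z)² = (42Z)²P⁴`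
  have f2 : ((x.p : ℝ) * (t + 6) * DirichletDisc.Zc) ^ 2 ≤ (3 * 14 * DirichletDisc.Zc) ^ 2 * bigP D ^ 4 := by
    have a : (x.p : ℝ) * (t + 6) * DirichletDisc.Zc ≤ 3 * bigP D * (14 * bigP D) * DirichletDisc.Zc := by
      apply mul_le_mul_of_nonneg_right _ hZ0
      exact mul_le_mul hp3 (by linarith) (by linarith) (by linarith)
    calc ((x.p : ℝ) * (t + 6) * DirichletDisc.Zc) ^ 2 ≤ (3 * bigP D * (14 * bigP D) * DirichletDisc.Zc) ^ 2 :=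
          pow_le_pow_left₀ (by positivity) a 2
      _ = (3 * 14 * DirichletDisc.Zc) ^ 2 * bigP D ^ 4 := by ring
  -- factor 3: the exponent
  have f3 : Real.exp (C * (1 + Real.log (1 / alpha D)) * (Real.log x.p + Real.log (|t| + 4))) ≤
      Real.exp (3 * C * ell D ^ 9 * (1 + 9 * Real.log (ell D))) := by
    rw [Real.exp_le_exp, mul_assoc]
    have h := Step8u016.log_factor_le hℓ hp1 hp3 ht4
    calc C * ((1 + Real.log (1 / alpha D)) * (Real.log x.p + Real.log (|t| + 4)))
        ≤ C * ((1 + 9 * Real.log (ell D)) * (3 * ell D ^ 9)) := mul_le_mul_of_nonneg_left h hC0.le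
      _ = 3 * C * ell D ^ 9 * (1 + 9 * Real.log (ell D)) := by ring
  -- factor 4: `K_B(P+1)⁴ ≤ K_B·16·P⁴`
  have f4 : KB * (bigP D + 1) ^ 4 ≤ KB * 16 * bigP D ^ 4 := by
    have a : (bigP D + 1) ^ 4 ≤ (2 * bigP D) ^ 4 := pow_le_pow_left₀ (by linarith) (by linarith) 4
    calc KB * (bigP D + 1) ^ 4 ≤ KB * (2 * bigP D) ^ 4 := mul_le_mul_of_nonneg_left a hKB0
      _ = KB * 16 * bigP D ^ 4 := by ring
  -- factor 5: `2Pt₀ + 1 ≤ 3P²`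
  have f5 : 2 * bigP D * t0 D + 1 ≤ 3 * bigP D ^ 2 := by
    have hPP : bigP D * t0 D ≤ bigP D ^ 2 := by
      rw [sq]; exact mul_le_mul_of_nonneg_left ht0P hP0.le
    have h1 : (1 : ℝ) ≤ bigP D ^ 2 := one_le_pow₀ hP1
    linarith
  -- combine
  have hbase := norm_mainU008_omega_le_left c' x hC h22 hℓ hα0 hα6 hcα hu1 hu2 htabs htabs1
  refine hbase.trans ?_
  have n2 : 0 ≤ ((x.p : ℝ) * (t + 6) * DirichletDisc.Zc) ^ 2 := sq_nonneg _
  have n3 : 0 ≤ Real.exp (C * (1 + Real.log (1 / alpha D)) * (Real.log x.p + Real.log (|t| + 4))) :=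
    (Real.exp_pos _).le
  have n4 : 0 ≤ KB * (bigP D + 1) ^ 4 := by positivity
  have ht00 : 0 ≤ t0 D := by linarith
  have n5 : 0 ≤ 2 * bigP D * t0 D + 1 :=
    add_nonneg (mul_nonneg (mul_nonneg (by norm_num) hP0.le) ht00) zero_le_one
  have g1 := mul_le_mul hDP f2 n2 hP0.le
  have g2 := mul_le_mul g1 f3 n3 (by positivity)
  have g3 := mul_le_mul g2 f4 n4 (by positivity)
  have g4 := mul_le_mul g3 f5 n5 (by positivity)
  have g5 := mul_le_mul_of_nonneg_right g4 (Real.exp_pos (2 - ell D ^ 10 / 4)).le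
  refine g5.trans (le_of_eq ?_)
  rw [hKB]; ring

end EdgeBound

/-! ## D. (γ): the exact left move of `M₁ω`, summed over `Ψ₁` -/

set_option maxHeartbeats 400000 in
/-- **u008 part (γ) as an edge from Proposition 2.2 (i)**: if for `ψ ∈ Ψ₁` the zeros of `L(s,ψ)L(s,ψχ)`
in `Ω` lie on the critical line (`Skeleton.Prop22i`), then for every `c′` the exact move of the u008
main term costs `O(ε)`:
`‖Σ_{ψ∈Ψ₁}(1/2πi)∫_{𝔍(−α)}M₁ω − Σ_{ψ∈Ψ₁}(1/2πi)∫_{𝔍(−1)}M₁ω‖ ≤ 1·e^{−𝓛¹⁰/16}` for all large `D`.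
Cauchy's theorem on `[−½, ½−α]×[2πt₀−𝓛₁, 2πt₀+𝓛₁]` per `ψ` (`Section7aStatements.norm_intJ_sub_intJ_le`,
holomorphy `differentiableOn_mainU008_omega_left`), the sides by `norm_mainU008_omega_le_left_uniform`,
`#Ψ₁ ≤ 𝔓 ≤ 4P²`, growth bookkeeping `growth_le_left`. [cite: Zhang2022LandauSiegel, §15 p. 80 (u008), tex L4033] -/
theorem step15_u008gamma_of_prop22i (h22 : Prop22i) (c' : ℝ) :
    ∃ c : ℝ, 0 < c ∧ ∃ C : ℝ, ForAllLarge fun D _ χ => AssumptionA D χ →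
      ‖(∑ x ∈ finsetOf (PsiOne χ), Lemma81.segInt (t0 D) (ell1 D) ((-alpha D : ℝ) : ℂ) (fun s =>
          GammaFactor.tau χ * χ (x.p : ZMod D) * conj (x.ψ (D : ZMod x.p)) *
            (((x.p : ℝ) * t0 D : ℝ) : ℂ) ^ (-beta3 c' D) * (D : ℂ) ^ (s - 1) *
            (x.ψ⁻¹.LFunction (1 - s - beta1 c' D) * x.ψ⁻¹.LFunction (1 - s - beta2 c' D) /
              x.ψ⁻¹.LFunction (1 - s)) *
            Bpoly χ x s * Kchar D (psiBarFn x) (1 - s - beta3 c' D) * omegaW D s)) -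
        ∑ x ∈ finsetOf (PsiOne χ), Lemma81.segInt (t0 D) (ell1 D) ((-1 : ℝ) : ℂ) (fun s =>
          GammaFactor.tau χ * χ (x.p : ZMod D) * conj (x.ψ (D : ZMod x.p)) *
            (((x.p : ℝ) * t0 D : ℝ) : ℂ) ^ (-beta3 c' D) * (D : ℂ) ^ (s - 1) *
            (x.ψ⁻¹.LFunction (1 - s - beta1 c' D) * x.ψ⁻¹.LFunction (1 - s - beta2 c' D) /
              x.ψ⁻¹.LFunction (1 - s)) *
            Bpoly χ x s * Kchar D (psiBarFn x) (1 - s - beta3 c' D) * omegaW D s)‖ ≤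
        C * Real.exp (-c * ell D ^ 10) := by
  classical
  obtain ⟨C, hC0, hC⟩ := DirichletDisc.exp_neg_le_norm_LFunction
  obtain ⟨D₁, h22'⟩ := h22
  obtain ⟨D₂, hfrakP⟩ := Step8u016.frakP_le_eventually
  have hZ1 : 1 ≤ DirichletDisc.Zc := DirichletDisc.one_le_Zc
  set K : ℝ := (3 * 14 * DirichletDisc.Zc) ^ 2 * ((1 + ‖iota2‖) * (‖iota3‖ + ‖iota4‖)) * 16 * 3 with hK
  have hK0 : 0 ≤ K := by
    have hι : 0 ≤ (1 + ‖iota2‖) * (‖iota3‖ + ‖iota4‖) := by positivity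
    rw [hK]
    exact mul_nonneg (mul_nonneg (mul_nonneg (sq_nonneg _) hι) (by norm_num)) (by norm_num)
  set L₀ : ℝ := max 3 (max (π * |c'| + 1) (max (4 * K + 3) ((8 * (16 + 57 * C)) ^ 2))) with hL₀
  refine ⟨1 / 16, by norm_num, 1, max (max D₁ D₂) (max ⌈Real.exp L₀⌉₊ 3), fun D _ χ hD hq hp hA => ?_⟩
  have hD₁ : D₁ ≤ D := le_trans (le_trans (le_max_left _ _) (le_max_left _ _)) hD
  have hD₂ : D₂ ≤ D := le_trans (le_trans (le_max_right _ _) (le_max_left _ _)) hD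
  have hDℓ : ⌈Real.exp L₀⌉₊ ≤ D := le_trans (le_trans (le_max_left _ _) (le_max_right _ _)) hD
  have hD3 : 3 ≤ D := le_trans (le_trans (le_max_right _ _) (le_max_right _ _)) hD
  have hM : L₀ ≤ ell D := Section4.le_ell_of_ceil_exp_le hDℓ
  have hℓ3 : 3 ≤ ell D := le_trans (le_max_left _ _) hM
  have hℓc : π * |c'| + 1 ≤ ell D := le_trans (le_trans (le_max_left _ _) (le_max_right _ _)) hM
  have hℓK : 4 * K + 3 ≤ ell D :=
    le_trans (le_trans (le_trans (le_max_left _ _) (le_max_right _ _)) (le_max_right _ _)) hM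
  have hℓA : (8 * (16 + 57 * C)) ^ 2 ≤ ell D :=
    le_trans (le_trans (le_trans (le_max_right _ _) (le_max_right _ _)) (le_max_right _ _)) hM
  have hℓ1 : 1 ≤ ell D := by linarith
  have hℓ0 : 0 < ell D := by linarith
  have h22D := h22' D χ hD₁ hq hp
  obtain ⟨hα0, hα6, hα1⟩ := Step8u016.alpha_small hℓ3
  obtain ⟨-, -, hwin, -, hℓ10⟩ := window_sizes_left' hℓ3
  have hc8 : π * |c'| ≤ ell D ^ 8 := by
    have : ell D ≤ ell D ^ 8 := by
      calc ell D = ell D ^ 1 := (pow_one _).symm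
        _ ≤ ell D ^ 8 := pow_le_pow_right₀ hℓ1 (by norm_num)
    linarith
  -- the integrand, as a function of `x`
  set F : Chr D → ℂ → ℂ := fun x s =>
    GammaFactor.tau χ * χ (x.p : ZMod D) * conj (x.ψ (D : ZMod x.p)) *
      (((x.p : ℝ) * t0 D : ℝ) : ℂ) ^ (-beta3 c' D) * (D : ℂ) ^ (s - 1) *
      (x.ψ⁻¹.LFunction (1 - s - beta1 c' D) * x.ψ⁻¹.LFunction (1 - s - beta2 c' D) /
        x.ψ⁻¹.LFunction (1 - s)) *
      Bpoly χ x s * Kchar D (psiBarFn x) (1 - s - beta3 c' D) * omegaW D s with hF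
  -- the uniform side bound
  set Mval : ℝ := K * bigP D ^ 11 * Real.exp (3 * C * ell D ^ 9 * (1 + 9 * Real.log (ell D))) *
    Real.exp (2 - ell D ^ 10 / 4) with hMval
  have hMval0 : 0 ≤ Mval := by
    rw [hMval]
    exact mul_nonneg (mul_nonneg (mul_nonneg hK0 (pow_nonneg (Real.exp_pos _).le _))
      (Real.exp_pos _).le) (Real.exp_pos _).le
  -- per character
  have hper : ∀ x ∈ finsetOf (PsiOne χ),
      ‖Lemma81.segInt (t0 D) (ell1 D) ((-alpha D : ℝ) : ℂ) (F x) -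
        Lemma81.segInt (t0 D) (ell1 D) ((-1 : ℝ) : ℂ) (F x)‖ ≤ Mval := by
    intro x hx
    have hx' : x ∈ PsiOne χ := mem_of_mem_finsetOf hx
    have h22x : ∀ s ∈ prodZeroSetOmega χ x, s.re = 1 / 2 := h22D x hx'
    have hFd := differentiableOn_mainU008_omega_left c' χ x h22x hα0 hα1
    have hside : ∀ t : ℝ, (t = 2 * π * t0 D + ell1 D ∨ t = 2 * π * t0 D - ell1 D) →
        ∀ u ∈ Set.Icc (1 / 2 + (-1 : ℝ)) (1 / 2 + (-alpha D)),
          ‖F x ((u : ℂ) + ((t : ℝ) : ℂ) * I)‖ ≤ Mval := by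
      intro t ht u hu
      have h := norm_mainU008_omega_le_left_uniform c' hC0 hC x h22x hD3 hℓ3 hc8
        (u := u) (by linarith [hu.1]) (by linarith [hu.2]) ht
      rw [hMval, hK]
      simpa only [hF] using h
    have hmove := Section7aStatements.norm_intJ_sub_intJ_le D (z₁ := -1) (z₂ := -alpha D)
      (M₁ := Mval) (M₂ := Mval) (by linarith) hFd (hside _ (Or.inl rfl)) (hside _ (Or.inr rfl))
    have hI : Lemma81.segInt (t0 D) (ell1 D) ((-alpha D : ℝ) : ℂ) (F x) -
        Lemma81.segInt (t0 D) (ell1 D) ((-1 : ℝ) : ℂ) (F x) =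
        (Section7aStatements.intJ D (-alpha D) (F x) - Section7aStatements.intJ D (-1) (F x)) /
          (2 * π * I) := by
      rw [Step8u016.segInt_eq_intJ_div, Step8u016.segInt_eq_intJ_div, sub_div]
    have hnorm2 : ‖(2 : ℂ) * π * I‖ = 2 * π := by
      rw [norm_mul, norm_mul, Complex.norm_I, mul_one, Complex.norm_real, Real.norm_eq_abs,
        abs_of_pos Real.pi_pos]
      norm_num
    rw [hI, norm_div, hnorm2, div_le_iff₀ (by positivity)]
    calc ‖Section7aStatements.intJ D (-alpha D) (F x) - Section7aStatements.intJ D (-1) (F x)‖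
        ≤ (-alpha D - -1) * (Mval + Mval) := hmove
      _ ≤ 1 * (Mval + Mval) := by gcongr; linarith
      _ ≤ Mval * (2 * π) := by nlinarith [Real.pi_gt_three]
  -- summing over `Ψ₁`
  have hsum : ‖(∑ x ∈ finsetOf (PsiOne χ), Lemma81.segInt (t0 D) (ell1 D) ((-alpha D : ℝ) : ℂ) (F x)) -
      ∑ x ∈ finsetOf (PsiOne χ), Lemma81.segInt (t0 D) (ell1 D) ((-1 : ℝ) : ℂ) (F x)‖ ≤
      (finsetOf (PsiOne χ)).card * Mval := by
    rw [← Finset.sum_sub_distrib]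
    calc ‖∑ x ∈ finsetOf (PsiOne χ), (Lemma81.segInt (t0 D) (ell1 D) ((-alpha D : ℝ) : ℂ) (F x) -
          Lemma81.segInt (t0 D) (ell1 D) ((-1 : ℝ) : ℂ) (F x))‖
        ≤ ∑ x ∈ finsetOf (PsiOne χ), ‖Lemma81.segInt (t0 D) (ell1 D) ((-alpha D : ℝ) : ℂ) (F x) -
          Lemma81.segInt (t0 D) (ell1 D) ((-1 : ℝ) : ℂ) (F x)‖ := norm_sum_le _ _
      _ ≤ ∑ x ∈ finsetOf (PsiOne χ), Mval := Finset.sum_le_sum hper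
      _ = (finsetOf (PsiOne χ)).card * Mval := by rw [Finset.sum_const, nsmul_eq_mul]
  have hcard : ((finsetOf (PsiOne χ)).card : ℝ) ≤ 4 * bigP D ^ 2 :=
    (Ded81Edge.card_finsetOf_psiOne_le_frakP χ).trans (hfrakP D hD₂ hℓ1)
  have hgoal := hsum.trans ((mul_le_mul_of_nonneg_right hcard hMval0).trans (le_refl _))
  simp only [hF] at hgoal
  refine hgoal.trans ?_
  -- the final size estimate: `4P²·Mval ≤ e^{−𝓛¹⁰/16}`
  have hP : bigP D = Real.exp (ell D ^ 9) := rfl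
  have hgrowth := growth_le_left (K₀ := 16) hC0.le (by norm_num) hℓ1 (by
    calc 8 * (16 + 57 * C) = Real.sqrt ((8 * (16 + 57 * C)) ^ 2) := by
          rw [Real.sqrt_sq (by positivity)]
      _ ≤ Real.sqrt (ell D) := Real.sqrt_le_sqrt hℓA)
  have hconst : 4 * K * Real.exp 2 ≤ Real.exp (3 * ell D ^ 9) := by
    have h9 : ell D ≤ ell D ^ 9 := by
      calc ell D = ell D ^ 1 := (pow_one _).symm
        _ ≤ ell D ^ 9 := pow_le_pow_right₀ hℓ1 (by norm_num)
    have h1 : 4 * K ≤ Real.exp (ell D ^ 9) := by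
      have : 4 * K ≤ ell D := by linarith
      calc 4 * K ≤ ell D ^ 9 := this.trans h9
        _ ≤ Real.exp (ell D ^ 9) := by linarith [Real.add_one_le_exp (ell D ^ 9)]
    have h2 : Real.exp 2 ≤ Real.exp (2 * ell D ^ 9) := Real.exp_le_exp.mpr (by nlinarith)
    calc 4 * K * Real.exp 2 ≤ Real.exp (ell D ^ 9) * Real.exp (2 * ell D ^ 9) :=
          mul_le_mul h1 h2 (Real.exp_pos _).le (Real.exp_pos _).le
      _ = Real.exp (3 * ell D ^ 9) := by rw [← Real.exp_add]; ring_nf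
  have hexp2 : Real.exp (2 - ell D ^ 10 / 4) = Real.exp 2 * Real.exp (-(ell D ^ 10 / 4)) := by
    rw [← Real.exp_add]; ring_nf
  calc 4 * bigP D ^ 2 * Mval
      = (4 * K * Real.exp 2) * (bigP D ^ 13 *
          Real.exp (3 * C * ell D ^ 9 * (1 + 9 * Real.log (ell D))) * Real.exp (-(ell D ^ 10 / 4))) := by
        rw [hMval, hexp2]; ring
    _ ≤ Real.exp (3 * ell D ^ 9) * (bigP D ^ 13 *
          Real.exp (3 * C * ell D ^ 9 * (1 + 9 * Real.log (ell D))) * Real.exp (-(ell D ^ 10 / 4))) :=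
        mul_le_mul_of_nonneg_right hconst (mul_nonneg (mul_nonneg (pow_nonneg (Real.exp_pos _).le _)
          (Real.exp_pos _).le) (Real.exp_pos _).le)
    _ = Real.exp (3 * ell D ^ 9 + 13 * ell D ^ 9 + 3 * C * ell D ^ 9 * (1 + 9 * Real.log (ell D)) +
          -(ell D ^ 10 / 4)) := by
        rw [hP, ← Real.exp_nat_mul, ← Real.exp_add, ← Real.exp_add, ← Real.exp_add]; ring_nf
    _ ≤ 1 * Real.exp (-(1 / 16) * ell D ^ 10) := by
        rw [one_mul, Real.exp_le_exp]
        have : 3 * ell D ^ 9 + 13 * ell D ^ 9 + 3 * C * ell D ^ 9 * (1 + 9 * Real.log (ell D)) =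
            (16 + 3 * C) * ell D ^ 9 + 27 * C * ell D ^ 9 * Real.log (ell D) := by ring
        rw [this]
        have h10 : 0 ≤ ell D ^ 10 := by positivity
        linarith

/-- **u008 part (γ) HOLDS for every `c′`, BY NAME** — the typed node
`Typed.Section15A.Step15_u008gamma c′` (`TypedSection15ASubsteps`, RT15-int-1; its `mainU008alpha` is
the inline `M₁` above by `rfl`), from `step15_u008gamma_of_prop22i` and the tree theorem
`Skeleton.prop22i_holds`. [cite: Zhang2022LandauSiegel, §15 p. 80 (u008), tex L4033] -/
theorem step15_u008gamma_holds (c' : ℝ) : Step15_u008gamma c' :=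
  step15_u008gamma_of_prop22i prop22i_holds c'

end Literature.NumberTheory.LFunctions.Zhang2022.Step15u008
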